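import Mathlib
import HarnessLib
import Summits.ValiantsHypothesis.ValiantsHypothesis.Theses.MonotoneRestoration
import Literature.Computability.AlgebraicComplexity.ArithCircuit
import Literature.Computability.AlgebraicComplexity.ArithCircuitProofs
import Literature.Computability.AlgebraicComplexity.MonotoneStructure
import Literature.Computability.AlgebraicComplexity.PermanentIrreducible
import Literature.ModelTheory.FiniteModelTheory.CkEquiv
import Summits.ValiantsHypothesis.ValiantsHypothesis.Theorems.MonotoneRestorationMonotoneRestorationQPCosetCount
import Summits.ValiantsHypothesis.ValiantsHypothesis.Theorems.MonotoneRestorationMonotoneRestorationQPSymmetricLB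
import Summits.ValiantsHypothesis.ValiantsHypothesis.Theorems.MonotoneRestorationMonotoneRestorationQPSupportSymmetrisation
import Summits.ValiantsHypothesis.ValiantsHypothesis.Theorems.MonotoneRestorationMonotoneRestorationQPSparseRegime
import Summits.ValiantsHypothesis.ValiantsHypothesis.Theorems.MonotoneRestorationMonotoneRestorationQPBeta
import Literature.Computability.AlgebraicComplexity.SymmetricArithCircuit
import Literature.Computability.AlgebraicComplexity.DawarWilsenach2025Proofs
import Literature.GroupTheory.PermutationGroups.SmallIndexSubgroups
import Summits.ValiantsHypothesis.ValiantsHypothesis.Theorems.MonotoneRestorationQP.Negative.LoadBearing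
import Summits.ValiantsHypothesis.ValiantsHypothesis.Theorems.MonotoneRestorationMonotoneRestorationQPPermSupportCount

/-! TTRL-lite variant V18942 of stmt-ValiantsHypothesis-15886 -/

-- `Summit.ValiantsHypothesis.ValiantsHypothesis.…` is the tree's mandated single-conjunct layout
-- (Sub = Summit), so the duplicated namespace component is intended.
set_option linter.dupNamespace false

namespace Summit.ValiantsHypothesis.ValiantsHypothesis.Theorems

open Summit.ValiantsHypothesis.ValiantsHypothesis.Theses.MonotoneRestoration
open Literature.Computability.AlgebraicComplexity

/-- **TTRL-lite variant V18942 of `stub_mulGate_children_extend`** (support of a product over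
`ℝ≥0` is the sumset of the supports): for `p q : MvPolynomial (Fin n × Fin n) ℝ≥0`,
`supp (p * q) = {a + b | a ∈ supp p, b ∈ supp q}`. The inclusion `⊆` holds over any semiring
(`MvPolynomial.support_mul`); the inclusion `⊇` is the no-cancellation lemma
`add_mem_support_mul` — all coefficients are nonnegative, so the `(a, b)` term of the convolution
already makes the coefficient of `a + b` nonzero. This is the set-level identity from which both
conjuncts of the parent stub are read off. [folklore] -/
theorem stub_mulGate_children_extend_var18942 :
    ∀ (n : ℕ) (p q : MvPolynomial (Fin n × Fin n) NNReal),
      (p * q).support = Finset.image₂ (· + ·) p.support q.support := by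
  intro n p q
  ext m
  rw [Finset.mem_image₂]
  constructor
  · intro hm
    obtain ⟨a, ha, b, hb, hab⟩ := Finset.mem_add.mp (MvPolynomial.support_mul p q hm)
    exact ⟨a, ha, b, hb, hab⟩
  · rintro ⟨a, ha, b, hb, rfl⟩
    exact add_mem_support_mul ha hb

end Summit.ValiantsHypothesis.ValiantsHypothesis.Theorems
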